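import Literature.MathematicalPhysics.QuantumFieldTheory.Balaban1983to89.B7Prop6GeneralAnalytic

/-!
# `Balaban1983to89.B7Prop4GeneralCk` — T. Bałaban, *Averaging operations for lattice gauge theories*, Commun. Math. Phys.
**98** (1985) 17–51 [Balaban1985Averaging]: (134) IN FRÉCHET FORM and (136) AT A GENERAL BACKGROUND `U₀` — the remainder
`C_k(U₀, ·)(c)` on the insertion space `𝔸^S` is analytic, vanishes at `0` together with its derivative, and its power series
begins at second order; k-uniform hypotheses, unconditional

statement-level skeleton of published theorems with citation tags; proofs where landed; nothing here is a claim about the Yang–Mills mass gap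

PDF held: `paper:balaban1985-cmp98-averaging` (journal page = PDF page + 16); renders `…/1985-cmp98-averaging-p022-x2.png` (p. 38) and
`p023-x2.png` (p. 39), read as images by the unit.

CITATION HEADER (lean-in-tree rule).  Cell `lit-balaban` (HOME `run/shared/lean/pub/lit-balaban/`), unit `lit-balaban-r04` (B7
reader/typer, gen 3; TAKING line HOME/STATUS.md 2026-08-21T04:07Z) — KERNEL PIECES for SKELETON row `B7.Prop4`, displays (134) and
(136), at a general background; the flat twins (`U₀ = 1`) are `B7Prop4Flat.hasDerivAt_logIter_ins_dir`, `hasFDerivAt_logIter_ins`,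
`prop4_flat_Ck_ins`, `prop4_flat_Ck_powerSeries`, whose architecture this file mirrors decl by decl.

PRINT.  p. 38: "**Proposition 4.** … the function `Q_k(U₀, ηA, c) = (1/i) log(U̿₁ᵏ)_c` … is an analytic function of `A_b`, `b ⊂ Bᵏ(c₋) ∪
Bᵏ(c₊)`, and `Q_k(U₀, ηA) = Q_k(U₀)A + C_k(U₀, A)`, (134) `|C_k(U₀, A)| ≦ C₂|A|² < C₂α₁²` (135)"; p. 38 (before (130)): "A composition
of k operators Q is the operator Q_k"; p. 39: "The function `C_k` can be decomposed further into a sum of homogeneous polynomials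
`C_k(U₀, A) = C_k^{(2)}(U₀, A) + C_k^{(3)}(U₀, A) + …`. (136)"; p. 39 (137): "`dF(A, δA) = (d/dt) F(A + tδA)|_{t=0}`".

WHAT THIS FILE PROVES (kernel, no `sorry`, standard axioms).  Standing data = those of `B7Eq123General.prop4_general` for the
background (`L ≥ 2`; `U₀` `G`-valued, `AvgClosed`; (52) `pdev U₀ < α₀L^{−2k}`; `C₀α₀ ≤ ⅓`; `4α₀ ≤ c₂′(d,L)`) and a radius `ρ > 0`
below the Prop.-4 thresholds (`e^{4cα₀}(1 + 8C₁Lᵏρ) ≤ 2`, `2Lᵏρ ≤ c₃(d,L)`; `c = 800(d+1)²(d+4)`, `C₁ = 131072(d+1)²`), on the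
insertion space `𝔸^S` of a finite bond set `S` (`B7Prop3Flat.insCfg`; print's "`A_b, b ⊂ Bᵏ(c₋) ∪ Bᵏ(c₊)`" is the case `S ⊇` those bonds).
* §1 `logCovIter_zero_field` (`Q_j(U₀, 0) = 0`), `linCovIter_csmul` (the composed linear part `LʲηQ_j(U₀)A` is `ℂ`-homogeneous in
  `A` at the regular level backgrounds — `B7Prop3GeneralTild.linQcov_smul`).
* §2 **`hasDerivAt_logCovIter_ins_dir`** — the differential (137) of `A ↦ Q_k(U₀, A)(c)` at `A = 0` in the direction `v ∈ 𝔸^S`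
  equals the composed linear part `LᵏηQ_k(U₀)v(c)` = `linCovIter L U₀ (insCfg S v) k c`, from the quadratic bound (130) at a general
  background (`B7Eq123General.prop4_general`) along the complex line `t ↦ tv`.
* §3 **`hasFDerivAt_logCovIter_ins`** = **(134) IN FRÉCHET FORM AT A GENERAL BACKGROUND**: `A ↦ Q_k(U₀, A)(c)` is Fréchet-differentiable
  at `0` on `𝔸^S` (it is analytic there, `B7Prop6GeneralAnalytic.prop4_general_analyticAt`) and its derivative is the continuous linear
  form `A ↦ LᵏηQ_k(U₀)A(c)` (uniqueness of directional derivatives); `clm_linCovIter_ins`: that form IS `a ↦ linCovIter L U₀ (insCfg S a) k c`.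
* §4 **`prop4_general_Ck_ins`**, **`prop4_general_Ck_powerSeries`** = **(136) AT A GENERAL BACKGROUND**: `C_k(U₀, ·)(c) := Q_k − LᵏηQ_kA`
  is analytic on a neighbourhood of every point of the open polydisc `{∀ b ∈ S, ‖A_b‖ < ρ}`, `C_k(U₀, 0)(c) = 0`, its Fréchet derivative at
  `0` vanishes, and it has a power series at `0` whose terms of order `0` and `1` vanish ("`C_k = C_k^{(2)} + C_k^{(3)} + …`").
READINGS (lineage): `U1`/Banach carrier; `η` absorbed (`ρ` plays `ηα₁`); global objects on `ℤᵈ`; thresholds displayed separately.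
NOT CLAIMED: the identification of the individual homogeneous terms `C_k^{(m)}` with print's later formulas; (135) is
`B7Eq123General.prop4_general` (i) and is only USED here.
DECLARATIONS: theorems only; single import `B7Prop6GeneralAnalytic`; REUSED BY NAME: `B7Eq123General.prop4_general / level_data /
blockLoops_of_pdev`, `B7Prop6GeneralAnalytic.prop4_general_analyticAt`, `B7Prop4GeneralLevels.logCovIter / linCovIter`,
`B7Prop3GeneralLinear.Qcov_zero`, `B7Prop3GeneralTild.linQcov_smul`, `B7Prop3Flat.insCfg / insCfg_smul / insCfg_zero / analyticAt_insCfg /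
norm_insCfg_le / c3`, `B7Prop4Flat.isOpen_polydisc`.
Unit `lit-balaban-r04` (gen 3), 2026-08-21.

[cite: Balaban1985Averaging, Proposition 4 (134)–(135) p.38, (136) p.39, (137) p.39, (130) p.38, (127) p.37]
-/

noncomputable section

open NormedSpace Finset

namespace Literature.MathematicalPhysics.QuantumFieldTheory.Balaban1983to89.B7Prop4GeneralCk

open B7Prop1Explicit B7Prop2Explicit B7Prop3Flat MatrixLog B7Eq92Concrete B7Prop3GeneralAnalytic B7Prop3GeneralLinear
  B7Prop4GeneralLevels B7Prop6GeneralAnalytic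
open B7Prop3GeneralTild (linQcov_smul)

-- `Site` alone would resolve to the torus sites of `Setup.lean`; re-export the `ℤ^d` sites of `B7Prop1Explicit`.
export B7Prop1Explicit (Site)

variable {d : ℕ}

variable {𝔸 : Type*} [NormedRing 𝔸] [NormedAlgebra ℂ 𝔸] [CompleteSpace 𝔸] [NormOneClass 𝔸]

/-! ## §1 `Q_j(U₀, 0) = 0` and the `ℂ`-homogeneity of the composed linear part -/

omit [NormOneClass 𝔸] in
/-- `Q_j(U₀, 0) = 0`: at `A = 0` (`U₁ = 1`) every covariant iterate is the unit configuration and its logarithm vanishes (one step: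
`B7Prop3GeneralLinear.Qcov_zero`; p. 36 "its Taylor expansion begins with a first-order polynomial").
[cite: Balaban1985Averaging, p.36 (after (121)), (127) p.37] -/
theorem logCovIter_zero_field (L : ℕ) (U₀ : Site d → Fin d → 𝔸ˣ) :
    ∀ j : ℕ, logCovIter L U₀ (0 : Site d → Fin d → 𝔸) j = 0
  | 0 => rfl
  | j + 1 => by
    funext z κ
    rw [logCovIter_succ, logCovIter_zero_field L U₀ j]
    exact Qcov_zero L _ _ κ

/-- **The composed linear part `LʲηQ_j(U₀)A` is `ℂ`-homogeneous in `A`, `j ≤ k`** (a composite of the `ℂ`-linear one-step parts «L(Q(V₀)A)»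
at the level backgrounds `Ū₀ʲ`, `B7Prop3GeneralTild.linQcov_smul` — whose domain condition, the block loops of `Ū₀ʲ` in `|W − 1| < 1`,
is the regularity of the levels, `B7Eq123General.level_data` / `blockLoops_of_pdev`). [cite: Balaban1985Averaging, p.38 (before (130)), (125) p.36] -/
theorem linCovIter_csmul (L : ℕ) (hL : 2 ≤ L) {G : Subgroup 𝔸ˣ} (hG : AvgClosed d L G) (k : ℕ)
    (U₀ : Site d → Fin d → 𝔸ˣ) (hU₀ : ∀ x κ, U₀ x κ ∈ G) {α₀ : ℝ} (hα : 0 < α₀)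
    (hα3 : C0 d * α₀ ≤ 1 / 3) (hα4 : 4 * α₀ ≤ c2' d L) (h52 : pdev U₀ < α₀ * (((L : ℝ) ^ k)⁻¹) ^ 2)
    (c : ℂ) (A : Site d → Fin d → 𝔸) :
    ∀ j ≤ k, linCovIter L U₀ (c • A) j = c • linCovIter L U₀ A j := by
  have hL1 : 1 ≤ L := le_trans (by norm_num) hL
  have hlev := B7Eq123General.level_data L hL hG k U₀ hU₀ hα hα3 hα4 h52
  intro j
  induction j with
  | zero => intro _; rfl
  | succ j ih =>
    intro hjk
    have hj : j < k := Nat.lt_of_succ_le hjk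
    obtain ⟨hV₀, hβ0, hβ, hβmax⟩ := hlev j hj.le
    funext z κ
    obtain ⟨hreg, hα1⟩ := B7Eq123General.blockLoops_of_pdev hL1 hV₀ hβ0 hβ hβmax ((L : ℤ) • z) κ
    have hW : ∀ r : Fin d → Fin L,
        ‖((Wcx L (avgIter L U₀ j) ((L : ℤ) • z) κ (boxVec L r) : 𝔸ˣ) : 𝔸) - 1‖ < 1 := fun r =>
      ((hreg r).trans hα1).trans_lt (by norm_num)
    rw [linCovIter_succ, ih hj.le, linQcov_smul L _ c _ _ κ hW, Pi.smul_apply, Pi.smul_apply, linCovIter_succ]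

/-- the smallness hypotheses of `prop4_general` are monotone in `b` (private arithmetic helper). [folklore] -/
private theorem smallness_mono {L k : ℕ} {α₀ b ρ : ℝ} (hbρ : b ≤ ρ)
    (hρsmall : Real.exp (4 * (800 * ((d : ℝ) + 1) ^ 2 * ((d : ℝ) + 4)) * α₀)
      * (1 + 8 * (131072 * ((d : ℝ) + 1) ^ 2) * ((L : ℝ) ^ k * ρ)) ≤ 2)
    (hρc₃ : 2 * ((L : ℝ) ^ k * ρ) ≤ c3 d L) :
    Real.exp (4 * (800 * ((d : ℝ) + 1) ^ 2 * ((d : ℝ) + 4)) * α₀)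
        * (1 + 8 * (131072 * ((d : ℝ) + 1) ^ 2) * ((L : ℝ) ^ k * b)) ≤ 2 ∧
      2 * ((L : ℝ) ^ k * b) ≤ c3 d L := by
  have hLk : (0 : ℝ) ≤ (L : ℝ) ^ k := by positivity
  have hm : (L : ℝ) ^ k * b ≤ (L : ℝ) ^ k * ρ := mul_le_mul_of_nonneg_left hbρ hLk
  refine ⟨?_, by linarith⟩
  have hexp : 0 ≤ Real.exp (4 * (800 * ((d : ℝ) + 1) ^ 2 * ((d : ℝ) + 4)) * α₀) := (Real.exp_pos _).le
  have h1 : 1 + 8 * (131072 * ((d : ℝ) + 1) ^ 2) * ((L : ℝ) ^ k * b)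
      ≤ 1 + 8 * (131072 * ((d : ℝ) + 1) ^ 2) * ((L : ℝ) ^ k * ρ) := by
    have : 0 ≤ 8 * (131072 * ((d : ℝ) + 1) ^ 2) := by positivity
    nlinarith
  exact (mul_le_mul_of_nonneg_left h1 hexp).trans hρsmall

/-! ## §2 The directional derivative of `A ↦ Q_k(U₀, A)(c)` at `0` -/

/-- **DIRECTIONAL COMPLEX DERIVATIVE of `A ↦ Q_k(U₀, A)(c)` at `A = 0` on `𝔸^S` in the direction `v`** — the differential (137)
"`dF(A, δA) = (d/dt) F(A + tδA)|_{t=0}`" at `A = 0`, `δA = v`, AT A GENERAL BACKGROUND: it equals the composed linear part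
`LᵏηQ_k(U₀)v(c)` = `linCovIter L U₀ (insCfg S v) k c`, from the quadratic bound (130) along the complex line `t ↦ tv`
(`‖Q_k(U₀, tv) − LᵏηQ_k(U₀)(tv)‖ ≤ 8C₁e^{4cα₀}(Lᵏ|t|‖v‖)²` for `|t|‖v‖ ≤ ρ`, `B7Eq123General.prop4_general` (i)) and the homogeneity
`linCovIter_csmul`. [cite: Balaban1985Averaging, (137) p.39, (130) p.38, (134) p.38] -/
theorem hasDerivAt_logCovIter_ins_dir (S : Finset (Site d × Fin d)) (L : ℕ) (hL : 2 ≤ L) {G : Subgroup 𝔸ˣ}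
    (hG : AvgClosed d L G) (k : ℕ) (U₀ : Site d → Fin d → 𝔸ˣ) (hU₀ : ∀ x κ, U₀ x κ ∈ G) {α₀ : ℝ}
    (hα : 0 < α₀) (hα3 : C0 d * α₀ ≤ 1 / 3) (hα4 : 4 * α₀ ≤ c2' d L) (h52 : pdev U₀ < α₀ * (((L : ℝ) ^ k)⁻¹) ^ 2)
    {ρ : ℝ} (hρ : 0 < ρ)
    (hρsmall : Real.exp (4 * (800 * ((d : ℝ) + 1) ^ 2 * ((d : ℝ) + 4)) * α₀)
      * (1 + 8 * (131072 * ((d : ℝ) + 1) ^ 2) * ((L : ℝ) ^ k * ρ)) ≤ 2)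
    (hρc₃ : 2 * ((L : ℝ) ^ k * ρ) ≤ c3 d L) (z : Site d) (κ : Fin d) (v : S → 𝔸) :
    HasDerivAt (fun t : ℂ => logCovIter L U₀ (insCfg S (t • v)) k z κ) (linCovIter L U₀ (insCfg S v) k z κ) 0 := by
  have hL1 : 1 ≤ L := le_trans (by norm_num) hL
  set K : ℝ := 8 * (131072 * ((d : ℝ) + 1) ^ 2) * Real.exp (4 * (800 * ((d : ℝ) + 1) ^ 2 * ((d : ℝ) + 4)) * α₀)
    with hK_def
  have hK0 : 0 ≤ K := by positivity
  rw [hasDerivAt_iff_isLittleO_nhds_zero]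
  have h0 : logCovIter L U₀ (insCfg S ((0 : ℂ) • v)) k z κ = 0 := by
    rw [zero_smul, insCfg_zero, logCovIter_zero_field L U₀ k]; rfl
  refine (Asymptotics.IsBigO.of_bound (K * ((L : ℝ) ^ k * ‖v‖) ^ 2) ?_).trans_isLittleO
    (Asymptotics.isLittleO_pow_id (one_lt_two))
  rw [Metric.eventually_nhds_iff]
  refine ⟨ρ / (‖v‖ + 1), by positivity, fun h hh => ?_⟩
  rw [dist_zero_right] at hh
  -- the smallness at `b = ‖h‖‖v‖ ≤ ρ`
  have hb : ‖h‖ * ‖v‖ ≤ ρ := by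
    have hv1 : (0 : ℝ) < ‖v‖ + 1 := by positivity
    have h1 : ‖h‖ * (‖v‖ + 1) ≤ ρ := by
      have := (lt_div_iff₀ hv1).1 hh
      exact this.le
    nlinarith [norm_nonneg h, norm_nonneg v]
  obtain ⟨hs, hc⟩ := smallness_mono (d := d) (L := L) (k := k) (α₀ := α₀) hb hρsmall hρc₃
  have hbnd : ∀ x κ', ‖insCfg S (h • v) x κ'‖ ≤ ‖h‖ * ‖v‖ := fun x κ' =>
    (norm_insCfg_le S (h • v) x κ').trans (norm_smul h v).le
  have hE := (B7Eq123General.prop4_general L hL hG k U₀ hU₀ hα hα3 hα4 h52 (insCfg S (h • v)) (by positivity) hbnd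
    hs hc k le_rfl).1
  have hlin : h • linCovIter L U₀ (insCfg S v) k z κ = linCovIter L U₀ (insCfg S (h • v)) k z κ := by
    rw [insCfg_smul, linCovIter_csmul L hL hG k U₀ hU₀ hα hα3 hα4 h52 h (insCfg S v) k le_rfl, Pi.smul_apply,
      Pi.smul_apply]
  rw [zero_add, h0, sub_zero, hlin, norm_pow]
  calc ‖logCovIter L U₀ (insCfg S (h • v)) k z κ - linCovIter L U₀ (insCfg S (h • v)) k z κ‖
      ≤ K * ((L : ℝ) ^ k * (‖h‖ * ‖v‖)) ^ 2 := by rw [hK_def]; exact hE z κ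
    _ = K * ((L : ℝ) ^ k * ‖v‖) ^ 2 * ‖h‖ ^ 2 := by ring

/-! ## §3 (134) in Fréchet form at a general background -/

/-- **(134) IN FRÉCHET FORM AT A GENERAL BACKGROUND**: on `𝔸^S` the map `A ↦ Q_k(U₀, A)(c)` is Fréchet-differentiable at `A = 0` and
its derivative there is the continuous linear form `A ↦ LᵏηQ_k(U₀)A(c)` — "`Q_k(U₀, ηA) = Q_k(U₀)A + C_k(U₀, A)`" (134) with `Q_k(U₀)` "the
composition … of their linear parts" (p. 38) and `C_k` of second order ((135)–(136)).  Existence from analyticity at `0`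
(`B7Prop6GeneralAnalytic.prop4_general_analyticAt`), identification by uniqueness of the directional derivatives (§2).
[cite: Balaban1985Averaging, (134) p.38, p.38 (before (130)), (136) p.39] -/
theorem hasFDerivAt_logCovIter_ins (S : Finset (Site d × Fin d)) (L : ℕ) (hL : 2 ≤ L) {G : Subgroup 𝔸ˣ}
    (hG : AvgClosed d L G) (k : ℕ) (U₀ : Site d → Fin d → 𝔸ˣ) (hU₀ : ∀ x κ, U₀ x κ ∈ G) {α₀ : ℝ}
    (hα : 0 < α₀) (hα3 : C0 d * α₀ ≤ 1 / 3) (hα4 : 4 * α₀ ≤ c2' d L) (h52 : pdev U₀ < α₀ * (((L : ℝ) ^ k)⁻¹) ^ 2)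
    {ρ : ℝ} (hρ : 0 < ρ)
    (hρsmall : Real.exp (4 * (800 * ((d : ℝ) + 1) ^ 2 * ((d : ℝ) + 4)) * α₀)
      * (1 + 8 * (131072 * ((d : ℝ) + 1) ^ 2) * ((L : ℝ) ^ k * ρ)) ≤ 2)
    (hρc₃ : 2 * ((L : ℝ) ^ k * ρ) ≤ c3 d L) (z : Site d) (κ : Fin d) :
    ∃ Λ : (S → 𝔸) →L[ℂ] 𝔸,
      HasFDerivAt (fun a : S → 𝔸 => logCovIter L U₀ (insCfg S a) k z κ) Λ 0 ∧
        ∀ v, Λ v = linCovIter L U₀ (insCfg S v) k z κ := by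
  set f : (S → 𝔸) → 𝔸 := fun a => logCovIter L U₀ (insCfg S a) k z κ with hf
  have han : AnalyticAt ℂ f 0 := by
    obtain ⟨hs, hc⟩ := smallness_mono (d := d) (L := L) (k := k) (α₀ := α₀)
      (show ‖(0 : S → 𝔸)‖ ≤ ρ by rw [norm_zero]; exact hρ.le) hρsmall hρc₃
    exact prop4_general_analyticAt L hL hG k U₀ hU₀ hα hα3 hα4 h52 (fun a : S → 𝔸 => insCfg S a)
      (fun x κ' => analyticAt_insCfg S x κ' 0) (norm_nonneg _) (fun x κ' => norm_insCfg_le S 0 x κ') hs hc k le_rfl z κ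
  have hF : HasFDerivAt f (fderiv ℂ f 0) 0 := han.differentiableAt.hasFDerivAt
  refine ⟨fderiv ℂ f 0, hF, fun v => ?_⟩
  have hg : HasDerivAt (fun t : ℂ => t • v) v 0 := by
    simpa using (hasDerivAt_id (0 : ℂ)).smul_const v
  have hF' : HasFDerivAt f (fderiv ℂ f 0) ((0 : ℂ) • v) := by rwa [zero_smul]
  have h1 : HasDerivAt (f ∘ fun t : ℂ => t • v) (fderiv ℂ f 0 v) 0 := hF'.comp_hasDerivAt (0 : ℂ) hg
  exact h1.unique (hasDerivAt_logCovIter_ins_dir S L hL hG k U₀ hU₀ hα hα3 hα4 h52 hρ hρsmall hρc₃ z κ v)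

/-- **`A ↦ LᵏηQ_k(U₀)A(c)` on `𝔸^S` IS a continuous linear form** ("the operator Q_k", p. 38): there is a continuous `ℂ`-linear
`Λ : 𝔸^S → 𝔸` with `Λ a = linCovIter L U₀ (insCfg S a) k c` for every `a` (namely the Fréchet derivative of §3).
[cite: Balaban1985Averaging, p.38 (before (130)), (134) p.38] -/
theorem clm_linCovIter_ins (S : Finset (Site d × Fin d)) (L : ℕ) (hL : 2 ≤ L) {G : Subgroup 𝔸ˣ}
    (hG : AvgClosed d L G) (k : ℕ) (U₀ : Site d → Fin d → 𝔸ˣ) (hU₀ : ∀ x κ, U₀ x κ ∈ G) {α₀ : ℝ}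
    (hα : 0 < α₀) (hα3 : C0 d * α₀ ≤ 1 / 3) (hα4 : 4 * α₀ ≤ c2' d L) (h52 : pdev U₀ < α₀ * (((L : ℝ) ^ k)⁻¹) ^ 2)
    {ρ : ℝ} (hρ : 0 < ρ)
    (hρsmall : Real.exp (4 * (800 * ((d : ℝ) + 1) ^ 2 * ((d : ℝ) + 4)) * α₀)
      * (1 + 8 * (131072 * ((d : ℝ) + 1) ^ 2) * ((L : ℝ) ^ k * ρ)) ≤ 2)
    (hρc₃ : 2 * ((L : ℝ) ^ k * ρ) ≤ c3 d L) (z : Site d) (κ : Fin d) :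
    ∃ Λ : (S → 𝔸) →L[ℂ] 𝔸, ∀ a, Λ a = linCovIter L U₀ (insCfg S a) k z κ := by
  obtain ⟨Λ, -, hΛ⟩ := hasFDerivAt_logCovIter_ins S L hL hG k U₀ hU₀ hα hα3 hα4 h52 hρ hρsmall hρc₃ z κ
  exact ⟨Λ, hΛ⟩

/-! ## §4 (136) at a general background: the remainder begins at second order -/

/-- **Prop. 4 AT A GENERAL BACKGROUND, THE REMAINDER `C_k(U₀, A) := Q_k(U₀, A) − LᵏηQ_k(U₀)A` ON `𝔸^S` — (136) begins at second
order**: `A ↦ C_k(U₀, A)(c)` is analytic on a neighbourhood of every point of the open polydisc `{∀ b ∈ S, ‖A_b‖ < ρ}`, `C_k(U₀, 0)(c) = 0`,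
and its Fréchet derivative at `A = 0` VANISHES — p. 39: "The function `C_k` can be decomposed further into a sum of homogeneous
polynomials, `C_k(U₀, A) = C_k^{(2)}(U₀, A) + C_k^{(3)}(U₀, A) + …` . (136)" (no terms of order `0` and `1`; with the bound
`‖C_k‖ ≤ C₂(Lᵏb)²` of (135), `B7Eq123General.prop4_general`). [cite: Balaban1985Averaging, (134)–(135) p.38, (136) p.39] -/
theorem prop4_general_Ck_ins (S : Finset (Site d × Fin d)) (L : ℕ) (hL : 2 ≤ L) {G : Subgroup 𝔸ˣ}
    (hG : AvgClosed d L G) (k : ℕ) (U₀ : Site d → Fin d → 𝔸ˣ) (hU₀ : ∀ x κ, U₀ x κ ∈ G) {α₀ : ℝ}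
    (hα : 0 < α₀) (hα3 : C0 d * α₀ ≤ 1 / 3) (hα4 : 4 * α₀ ≤ c2' d L) (h52 : pdev U₀ < α₀ * (((L : ℝ) ^ k)⁻¹) ^ 2)
    {ρ : ℝ} (hρ : 0 < ρ)
    (hρsmall : Real.exp (4 * (800 * ((d : ℝ) + 1) ^ 2 * ((d : ℝ) + 4)) * α₀)
      * (1 + 8 * (131072 * ((d : ℝ) + 1) ^ 2) * ((L : ℝ) ^ k * ρ)) ≤ 2)
    (hρc₃ : 2 * ((L : ℝ) ^ k * ρ) ≤ c3 d L) (z : Site d) (κ : Fin d) :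
    AnalyticOnNhd ℂ (fun a : S → 𝔸 => logCovIter L U₀ (insCfg S a) k z κ - linCovIter L U₀ (insCfg S a) k z κ)
        {a | ∀ s, ‖a s‖ < ρ} ∧
      logCovIter L U₀ (insCfg S (0 : S → 𝔸)) k z κ - linCovIter L U₀ (insCfg S (0 : S → 𝔸)) k z κ = 0 ∧
      HasFDerivAt (fun a : S → 𝔸 => logCovIter L U₀ (insCfg S a) k z κ - linCovIter L U₀ (insCfg S a) k z κ)
        (0 : (S → 𝔸) →L[ℂ] 𝔸) 0 := by
  obtain ⟨Λ, hF, hΛ⟩ := hasFDerivAt_logCovIter_ins S L hL hG k U₀ hU₀ hα hα3 hα4 h52 hρ hρsmall hρc₃ z κ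
  have hlinfun : (fun a : S → 𝔸 => linCovIter L U₀ (insCfg S a) k z κ) = fun a => Λ a := funext fun a => (hΛ a).symm
  refine ⟨?_, ?_, ?_⟩
  · intro a ha
    have hna : ‖a‖ < ρ := (pi_norm_lt_iff hρ).2 ha
    obtain ⟨hs, hc⟩ := smallness_mono (d := d) (L := L) (k := k) (α₀ := α₀) hna.le hρsmall hρc₃
    have hlog : AnalyticAt ℂ (fun a : S → 𝔸 => logCovIter L U₀ (insCfg S a) k z κ) a :=
      prop4_general_analyticAt L hL hG k U₀ hU₀ hα hα3 hα4 h52 (fun a' : S → 𝔸 => insCfg S a')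
        (fun x κ' => analyticAt_insCfg S x κ' a) (norm_nonneg a) (fun x κ' => norm_insCfg_le S a x κ') hs hc k le_rfl z κ
    have hlin : AnalyticAt ℂ (fun a : S → 𝔸 => linCovIter L U₀ (insCfg S a) k z κ) a := by
      rw [hlinfun]; exact Λ.analyticAt a
    exact hlog.sub hlin
  · rw [← hΛ 0, map_zero, sub_zero, insCfg_zero, logCovIter_zero_field L U₀ k]; rfl
  · have hG' : HasFDerivAt (fun a : S → 𝔸 => linCovIter L U₀ (insCfg S a) k z κ) Λ 0 := by
      rw [hlinfun]; exact Λ.hasFDerivAt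
    have h := hF.sub hG'
    rwa [sub_self] at h

/-- **(136) AT A GENERAL BACKGROUND AS A STATEMENT ABOUT THE POWER SERIES**: `C_k(U₀, ·)(c)` has a power-series expansion at `A = 0` on
`𝔸^S`, `C_k(U₀, A)(c) = Σ_n p_n(A, …, A)` (`p_n` a continuous `n`-linear map, `p_n(A, …, A)` = the homogeneous polynomial `C_k^{(n)}(U₀, A)`
of degree `n`), and its terms of order `0` and `1` vanish: `p₀ = 0`, `p₁ = 0` — "`C_k(U₀, A) = C_k^{(2)}(U₀, A) + C_k^{(3)}(U₀, A) + …`"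
(136). [cite: Balaban1985Averaging, (136) p.39] -/
theorem prop4_general_Ck_powerSeries (S : Finset (Site d × Fin d)) (L : ℕ) (hL : 2 ≤ L) {G : Subgroup 𝔸ˣ}
    (hG : AvgClosed d L G) (k : ℕ) (U₀ : Site d → Fin d → 𝔸ˣ) (hU₀ : ∀ x κ, U₀ x κ ∈ G) {α₀ : ℝ}
    (hα : 0 < α₀) (hα3 : C0 d * α₀ ≤ 1 / 3) (hα4 : 4 * α₀ ≤ c2' d L) (h52 : pdev U₀ < α₀ * (((L : ℝ) ^ k)⁻¹) ^ 2)
    {ρ : ℝ} (hρ : 0 < ρ)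
    (hρsmall : Real.exp (4 * (800 * ((d : ℝ) + 1) ^ 2 * ((d : ℝ) + 4)) * α₀)
      * (1 + 8 * (131072 * ((d : ℝ) + 1) ^ 2) * ((L : ℝ) ^ k * ρ)) ≤ 2)
    (hρc₃ : 2 * ((L : ℝ) ^ k * ρ) ≤ c3 d L) (z : Site d) (κ : Fin d) :
    ∃ p : FormalMultilinearSeries ℂ (S → 𝔸) 𝔸,
      HasFPowerSeriesAt (fun a : S → 𝔸 => logCovIter L U₀ (insCfg S a) k z κ - linCovIter L U₀ (insCfg S a) k z κ) p 0 ∧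
        p 0 = 0 ∧ p 1 = 0 := by
  obtain ⟨hAn, h0, hD⟩ := prop4_general_Ck_ins S L hL hG k U₀ hU₀ hα hα3 hα4 h52 hρ hρsmall hρc₃ z κ
  obtain ⟨p, hp⟩ := hAn 0 fun s => by simpa using hρ
  refine ⟨p, hp, ?_, ?_⟩
  · ext v
    rw [hp.coeff_zero v]
    simpa using h0
  · have h1 := hp.fderiv_eq
    rw [hD.fderiv] at h1
    exact (continuousMultilinearCurryFin1 ℂ (S → 𝔸) 𝔸).map_eq_zero_iff.1 h1.symm

end Literature.MathematicalPhysics.QuantumFieldTheory.Balaban1983to89.B7Prop4GeneralCk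

end
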